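import Summits.ResolutionOfSingularities.ResolutionOfSingularities.Theorems.PurelyInseparableDim4UnitClassCone
import Mathlib.LinearAlgebra.Matrix.NonsingularInverse
import HarnessLib
import HarnessLib.Audit.Tags

/-!
# Purely inseparable four-folds — `e_G` THROUGH A RE-PRESENTATION WITH INVERTIBLE TANGENT: a linear substitution transports
# the polar kernel (cell `res-dim4-pi`, K2(p) lane, slice B, brick «UnitClassOrder» part 2/2, FILE C)

[OURS · counted 0 · cell `res-dim4-pi` · K2(p) lane (holder res-dim4-p-12, scope word 2026-08-29T04:43:23Z) · seat
res-dim4-p-7 g4 · consumer res-dim4-typ-1 g3 (K24b-R1 window skeleton, `stub_eG_transfer`: «ℛ² binders, invertible tangent,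
`x^r ∣` both, `ord₀` both ⊢ `finrank (resVertex B) = finrank (resVertex A)`», 2026-08-29T05:04:01Z).]  Nothing here proves
K2(p)/K2(5), `NoIsolatedTrap p p`, or resolution of singularities in dimension ≥ 4 / characteristic `p`.  AI kernel work,
weaker than expert review.

Over FILE B (`…UnitClassCone`: `resForm_of_slotUnit_rel` — `resForm B = c · J(resForm A)` for the canonical jet `J` of the
slot-unit class) the missing step is pure linear algebra: for the linear substitution `J_N k := Σ_l N k l · x_l` of a matrix
`N` with `IsUnit N.det`,
* §1 `aeval_linSubst_comp` (`J_{N′} ∘ J_N = J_{N N′}` on letters), **`aeval_linSubst_injective`** (inverse substitution from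
  `N⁻¹`);
* §2 the CHAIN RULE `pderiv_aeval_linSubst` (Literature `JacobianCriterion.pderiv_aeval`, `FrameChange.pderiv_linear`) and **`polarMap_aeval_linSubst`**:
  `polarMap (J_N g) v = J_N (polarMap g (N *ᵥ v))`; hence **`additiveSubspace_aeval_linSubst`**:
  `A(J_N g) = A(g).comap (toLin' N)` and **`finrank_additiveSubspace_aeval_linSubst`**: `finrank A(J_N g) = finrank A(g)`;
  `additiveSubspace_C_mul` (`A(c·g) = A(g)`, `c ≠ 0`);
* §3 **`finrank_resVertex_eq_of_slotUnit_rel`** = typ-1's stub: through the slot-unit class `ℛ²` with invertible tangent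
  (`hdet : IsUnit (Matrix.det (Matrix.of fun k i => coeff_{e_i}(θ k)))`, res-dim4-typ-1 g3's `isUnit_det_slotUnitClass₂`),
  boundary on the slots and `B.r = A.r♯`: `finrank K (resVertex B) = finrank K (resVertex A)` — `d`- and `p`-generic, no
  power-cone hypothesis (`additiveSubspace` is the polar kernel by definition); **`finrank_resVertex_eq_of_slotUnit_rel₂`** =
  the same in typ-1's named-slot binders (`la mu | u f`, ledgers `x_{πla}x_{πmu}` / `x_la x_mu`).
[cite: CossartJannsenSaito2020, Def. 2.18] [cite: Humphreys1990, §3.10 (chain rule)] [folklore]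
bears_on: LADDER-RESOLUTION:D157-DOOR2 (res-dim4-pi · K2(p) · slice B · UnitClassOrder C).  Supports
stmt-ResolutionOfSingularities-16155 (helper).
-/

set_option linter.dupNamespace false -- mandated namespace of this single-conjunct summit

noncomputable section

namespace Summit.ResolutionOfSingularities.ResolutionOfSingularities.Theorems.PIDim4

namespace SwapNorm

open MvPolynomial Finset
open Literature.AlgebraicGeometry.Resolution
open Literature.AlgebraicGeometry.Resolution.CentreBlowup
open Literature.AlgebraicGeometry.Resolution.Hauser2010
open Literature.AlgebraicGeometry.Resolution.HauserPerlega2019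
open PointBlowup (polarMap additiveSubspace)

variable {K : Type} [Field K]

/-! ## §1 Linear substitutions: composition and injectivity -/

/-- A linear substitution on a letter: `J_N(x_k) = Σ_l N k l · x_l`. [folklore] -/
theorem aeval_linSubst_X (N : Matrix (Fin 4) (Fin 4) K) (k : Fin 4) :
    aeval (fun k => ∑ l, C (N k l) * X l) (X k : MvPolynomial (Fin 4) K) = ∑ l, C (N k l) * X l := aeval_X _ k

/-- **Composition of linear substitutions on letters**: `J_{N′}(J_N(x_k)) = J_{N N′}(x_k)`. [folklore] -/
theorem aeval_linSubst_comp (N N' : Matrix (Fin 4) (Fin 4) K) (k : Fin 4) :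
    aeval (fun k => ∑ l, C (N' k l) * X l) (∑ l, C (N k l) * X l : MvPolynomial (Fin 4) K) =
      ∑ m, C ((N * N') k m) * X m := by
  rw [map_sum]
  simp only [map_mul, aeval_C, algebraMap_eq, aeval_X, mul_sum]
  rw [Finset.sum_comm]
  refine Finset.sum_congr rfl fun m _ => ?_
  rw [Matrix.mul_apply, map_sum, sum_mul]
  refine Finset.sum_congr rfl fun l _ => ?_
  rw [map_mul]; ring

/-- **A linear substitution with invertible matrix is injective** (its inverse is the substitution of `N⁻¹`). [folklore] -/
theorem aeval_linSubst_injective {N : Matrix (Fin 4) (Fin 4) K} (hN : IsUnit N.det) :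
    Function.Injective (aeval (fun k => ∑ l, C (N k l) * X l) :
      MvPolynomial (Fin 4) K → MvPolynomial (Fin 4) K) := by
  have hcomp : (aeval (fun k => ∑ l, C (N⁻¹ k l) * X l)).comp (aeval (fun k => ∑ l, C (N k l) * X l)) =
      AlgHom.id K (MvPolynomial (Fin 4) K) := by
    refine MvPolynomial.algHom_ext fun k => ?_
    rw [AlgHom.comp_apply, AlgHom.id_apply, aeval_X, aeval_linSubst_comp, Matrix.mul_nonsing_inv N hN,
      Finset.sum_eq_single k (fun m _ hmk => by rw [Matrix.one_apply_ne (Ne.symm hmk), C_0, zero_mul])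
        (fun h => absurd (mem_univ k) h), Matrix.one_apply_eq, C_1, one_mul]
  intro P Q h
  have := congrArg (aeval (fun k => ∑ l, C (N⁻¹ k l) * X l)) h
  rwa [← AlgHom.comp_apply, ← AlgHom.comp_apply, hcomp, AlgHom.id_apply, AlgHom.id_apply] at this

/-! ## §2 The polar kernel under a linear substitution -/

/-! `∂_i J_N(x_k) = N k i` is res-dim4-p-11's `FrameChange.pderiv_linear (N k) i` (`…TschirnhausCone`), imported. -/

/-- **Chain rule for a linear substitution**: `∂_i (J_N g) = Σ_k N k i · J_N(∂_k g)`.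
[cite: Humphreys1990, §3.10 (chain rule)] [folklore] -/
theorem pderiv_aeval_linSubst (N : Matrix (Fin 4) (Fin 4) K) (g : MvPolynomial (Fin 4) K) (i : Fin 4) :
    pderiv i (aeval (fun k => ∑ l, C (N k l) * X l) g) =
      ∑ k, C (N k i) * aeval (fun k => ∑ l, C (N k l) * X l) (pderiv k g) := by
  classical
  rw [Literature.Algebra.Polynomial.JacobianCriterion.pderiv_aeval]
  refine Finset.sum_congr rfl fun k _ => ?_
  rw [FrameChange.pderiv_linear (N k) i, mul_comm]

/-- **The polar map through a linear substitution**: `polarMap (J_N g) v = J_N (polarMap g (N *ᵥ v))`. [folklore] -/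
theorem polarMap_aeval_linSubst (N : Matrix (Fin 4) (Fin 4) K) (g : MvPolynomial (Fin 4) K) (v : Fin 4 → K) :
    polarMap (aeval (fun k => ∑ l, C (N k l) * X l) g) v =
      aeval (fun k => ∑ l, C (N k l) * X l) (polarMap g (N.mulVec v)) := by
  classical
  rw [NarrowApolarity.polarMap_apply, NarrowApolarity.polarMap_apply, map_sum]
  simp_rw [pderiv_aeval_linSubst, smul_sum, Matrix.mulVec, dotProduct]
  rw [Finset.sum_comm]
  refine Finset.sum_congr rfl fun k _ => ?_
  rw [map_smul, sum_smul]
  refine Finset.sum_congr rfl fun i _ => ?_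
  rw [smul_eq_C_mul, smul_eq_C_mul, map_mul]
  ring

/-- **THE POLAR KERNEL UNDER A LINEAR SUBSTITUTION**: for `IsUnit N.det`,
`A(J_N g) = A(g).comap (toLin' N)` (`v ∈ A(J_N g) ⟺ N *ᵥ v ∈ A(g)`). [cite: CossartJannsenSaito2020, Def. 2.18] [folklore] -/
theorem additiveSubspace_aeval_linSubst {N : Matrix (Fin 4) (Fin 4) K} (hN : IsUnit N.det) (g : MvPolynomial (Fin 4) K) :
    additiveSubspace (aeval (fun k => ∑ l, C (N k l) * X l) g) = (additiveSubspace g).comap (Matrix.toLin' N) := by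
  ext v
  unfold PointBlowup.additiveSubspace
  rw [Submodule.mem_comap, LinearMap.mem_ker, LinearMap.mem_ker, Matrix.toLin'_apply, polarMap_aeval_linSubst,
    ← map_zero (aeval (fun k => ∑ l, C (N k l) * X l) : MvPolynomial (Fin 4) K →ₐ[K] MvPolynomial (Fin 4) K)]
  exact (aeval_linSubst_injective hN).eq_iff

/-- **`finrank A(J_N g) = finrank A(g)`** for `IsUnit N.det`. [cite: CossartJannsenSaito2020, Def. 2.18] [folklore] -/
theorem finrank_additiveSubspace_aeval_linSubst {N : Matrix (Fin 4) (Fin 4) K} (hN : IsUnit N.det)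
    (g : MvPolynomial (Fin 4) K) :
    Module.finrank K (additiveSubspace (aeval (fun k => ∑ l, C (N k l) * X l) g)) =
      Module.finrank K (additiveSubspace g) := by
  have hNu : IsUnit N := (Matrix.isUnit_iff_isUnit_det N).mpr hN
  have hbij : Function.Bijective (Matrix.toLin' N) :=
    ⟨fun v w h => Matrix.mulVec_injective_iff_isUnit.mpr hNu (by simpa [Matrix.toLin'_apply] using h),
     fun w => by
      obtain ⟨v, hv⟩ := Matrix.mulVec_surjective_iff_isUnit.mpr hNu w
      exact ⟨v, by rw [Matrix.toLin'_apply]; exact hv⟩⟩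
  set e : (Fin 4 → K) ≃ₗ[K] (Fin 4 → K) := LinearEquiv.ofBijective (Matrix.toLin' N) hbij with he
  rw [additiveSubspace_aeval_linSubst hN,
    show (additiveSubspace g).comap (Matrix.toLin' N) = (additiveSubspace g).comap (e : (Fin 4 → K) →ₗ[K] (Fin 4 → K))
      from rfl, Submodule.comap_equiv_eq_map_symm, LinearEquiv.finrank_map_eq]

/-- Scaling by a non-zero constant does not change the polar kernel. [folklore] -/
theorem additiveSubspace_C_mul {c : K} (hc : c ≠ 0) (g : MvPolynomial (Fin 4) K) :
    additiveSubspace (C c * g) = additiveSubspace g := by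
  classical
  ext v
  unfold PointBlowup.additiveSubspace
  rw [LinearMap.mem_ker, LinearMap.mem_ker, NarrowApolarity.polarMap_apply, NarrowApolarity.polarMap_apply]
  have h : ∑ i, v i • pderiv i (C c * g) = C c * ∑ i, v i • pderiv i g := by
    rw [mul_sum]
    refine Finset.sum_congr rfl fun i _ => ?_
    rw [pderiv_C_mul, smul_eq_C_mul, smul_eq_C_mul]; ring
  rw [h, mul_eq_zero, C_eq_zero, or_iff_right hc]

/-! ## §3 `e_G` through the slot-unit class `ℛ²` -/

section SlotUnit

variable (p : ℕ)
variable {π : Equiv.Perm (Fin 4)} {u f : Fin 4} {θ e : Fin 4 → MvPolynomial (Fin 4) K}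

/-- **`e_G` THROUGH THE SLOT-UNIT CLASS WITH INVERTIBLE TANGENT** (res-dim4-typ-1 g3's `stub_eG_transfer`, generic):
`θ(x_{π i}) = x_i e_i` with units on the slots `i ∉ {u, f}`, `θ` origin-fixing, tangent matrix `N k i = coeff_{e_i}(θ(x_k))`
with `IsUnit N.det`; `B.F = clean_p(U^p · θ A.F) + E`, `E ∈ 𝔪₀ᴹ`, `U(0) ≠ 0`, `ord₀ A.F = o`, `p ∤ o`, `o < M`,
`x^{A.r} ∣ A.F` with `A.r` off `π u, π f`, `B.r = A.r♯` ⇒ `finrank K (resVertex B) = finrank K (resVertex A)` (and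
`resForm B = c · J_N(resForm A)`, `c ≠ 0`, by FILE B). [OURS] [cite: CossartJannsenSaito2020, Def. 2.18] -/
theorem finrank_resVertex_eq_of_slotUnit_rel (hθi : ∀ i, i ≠ u → i ≠ f → θ (π i) = X i * e i)
    (he : ∀ i, i ≠ u → i ≠ f → constantCoeff (e i) ≠ 0) (hθ0 : ∀ k, constantCoeff (θ k) = 0)
    (hdet : IsUnit (Matrix.det (Matrix.of fun k i => coeff (Finsupp.single i 1) (θ k))))
    {U E : MvPolynomial (Fin 4) K} {A B : State K} (hU : constantCoeff U ≠ 0) {M o : ℕ} (hE : E ∈ originIdeal K ^ M)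
    (hrel : B.F = deletePthPowers p (U ^ p * aeval θ A.F) + E) (ho : ordZero A.F = o) (hpo : ¬ p ∣ o) (hoM : o < M)
    (hrA : ∀ d ∈ A.F.support, A.r ≤ d) (hru : A.r (π u) = 0) (hrf : A.r (π f) = 0)
    (hrB : B.r = A.r.mapDomain π.symm) :
    Module.finrank K (ResCone.resVertex B) = Module.finrank K (ResCone.resVertex A) := by
  classical
  set N : Matrix (Fin 4) (Fin 4) K := Matrix.of fun k i => coeff (Finsupp.single i 1) (θ k) with hN
  have hJN : (fun k => ∑ l, C (coeff (Finsupp.single l 1) (θ k)) * X l) =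
      (fun k => ∑ l, C (N k l) * X l : Fin 4 → MvPolynomial (Fin 4) K) := by
    funext k; rfl
  -- `J_N(in A.F) ≠ 0` by injectivity
  have hin0 : initialForm A.F ≠ 0 := by
    intro h0
    have h1 := Directrix.initialForm_eq_homogeneousComponent ho
    rw [h0] at h1
    obtain ⟨⟨d, hd, hdeg⟩, -⟩ := (ordZero_eq_nat_iff _ _).mp ho
    have h2 : coeff d (homogeneousComponent o A.F) = coeff d A.F := by rw [coeff_homogeneousComponent, if_pos hdeg]
    rw [← h1, coeff_zero] at h2
    exact hd h2.symm
  have hJ0 : aeval (fun k => ∑ l, C (coeff (Finsupp.single l 1) (θ k)) * X l) (initialForm A.F) ≠ 0 := by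
    rw [hJN, ← map_zero (aeval (fun k => ∑ l, C (N k l) * X l) : MvPolynomial (Fin 4) K →ₐ[K] MvPolynomial (Fin 4) K)]
    exact fun h => hin0 (aeval_linSubst_injective hdet h)
  obtain ⟨c, hc, hres⟩ := resForm_of_slotUnit_rel p hθi he hθ0 hU hE hrel ho hpo hoM hJ0 hrA hru hrf hrB
  unfold ResCone.resVertex
  rw [hres, additiveSubspace_C_mul hc, hJN, finrank_additiveSubspace_aeval_linSubst hdet]


/-- Four pairwise distinct letters exhaust `Fin 4`: a letter off `u, f` is one of the two slots. [folklore] -/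
theorem eq_slot_of_ne {la mu u f : Fin 4} (hlm : la ≠ mu) (hlu : la ≠ u) (hlf : la ≠ f) (hmu : mu ≠ u)
    (hmf : mu ≠ f) (huf : u ≠ f) {i : Fin 4} (hiu : i ≠ u) (hif : i ≠ f) : i = la ∨ i = mu := by
  by_contra h
  push Not at h
  have h1 := Fin.val_ne_of_ne hlm; have h2 := Fin.val_ne_of_ne hlu; have h3 := Fin.val_ne_of_ne hlf
  have h4 := Fin.val_ne_of_ne hmu; have h5 := Fin.val_ne_of_ne hmf; have h6 := Fin.val_ne_of_ne huf
  have h7 := Fin.val_ne_of_ne hiu; have h8 := Fin.val_ne_of_ne hif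
  have h9 := Fin.val_ne_of_ne h.1; have h10 := Fin.val_ne_of_ne h.2
  have := la.isLt; have := mu.isLt; have := u.isLt; have := f.isLt; have := i.isLt
  omega

/-- **`e_G` THROUGH THE SLOT-UNIT CLASS — res-dim4-typ-1 g3's `stub_eG_transfer` binders** (named slots `la, mu`, free
letters `u, f`, ledgers `x_{πla} x_{πmu}` / `x_la x_mu`, order `o` prime to `p`, `o < M`; the 4×4 tangent `IsUnit` is
typ-1's `isUnit_det_slotUnitClass₂` applied to the free `2×2` block). [OURS] [cite: CossartJannsenSaito2020, Def. 2.18] -/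
theorem finrank_resVertex_eq_of_slotUnit_rel₂ {la mu : Fin 4} (hlm : la ≠ mu) (hlu : la ≠ u) (hlf : la ≠ f)
    (hmu : mu ≠ u) (hmf : mu ≠ f) (huf : u ≠ f) {A B : State K} {U E : MvPolynomial (Fin 4) K} {M o : ℕ}
    (hθa : θ (π la) = X la * e la) (hθa' : θ (π mu) = X mu * e mu) (hea : constantCoeff (e la) ≠ 0)
    (hea' : constantCoeff (e mu) ≠ 0) (hu0 : constantCoeff (θ (π u)) = 0) (hf0 : constantCoeff (θ (π f)) = 0)
    (hdet : IsUnit (Matrix.det (Matrix.of fun k i => coeff (Finsupp.single i 1) (θ k))))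
    (hU : constantCoeff U ≠ 0) (hE : E ∈ originIdeal K ^ M) (hrel : B.F = deletePthPowers p (U ^ p * aeval θ A.F) + E)
    (hrA : A.r = Finsupp.single (π la) 1 + Finsupp.single (π mu) 1) (hrB : B.r = Finsupp.single la 1 + Finsupp.single mu 1)
    (hdivA : ∀ d ∈ A.F.support, A.r ≤ d) (hoA : ordZero A.F = o) (hpo : ¬ p ∣ o) (hoM : o < M) :
    Module.finrank K (ResCone.resVertex B) = Module.finrank K (ResCone.resVertex A) := by
  have hslot := fun (i : Fin 4) (hiu : i ≠ u) (hif : i ≠ f) => eq_slot_of_ne hlm hlu hlf hmu hmf huf hiu hif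
  have hθi : ∀ i, i ≠ u → i ≠ f → θ (π i) = X i * e i := fun i hiu hif => by
    rcases hslot i hiu hif with rfl | rfl
    · exact hθa
    · exact hθa'
  have he : ∀ i, i ≠ u → i ≠ f → constantCoeff (e i) ≠ 0 := fun i hiu hif => by
    rcases hslot i hiu hif with rfl | rfl
    · exact hea
    · exact hea'
  have hθ0 : ∀ k, constantCoeff (θ k) = 0 := fun k => by
    obtain ⟨i, rfl⟩ := π.surjective k
    by_cases hiu : i = u
    · subst hiu; exact hu0
    by_cases hif : i = f
    · subst hif; exact hf0
    rw [hθi i hiu hif, map_mul, constantCoeff_X, zero_mul]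
  have hπu : π u ≠ π la ∧ π u ≠ π mu := ⟨fun h => hlu (π.injective h).symm, fun h => hmu (π.injective h).symm⟩
  have hπf : π f ≠ π la ∧ π f ≠ π mu := ⟨fun h => hlf (π.injective h).symm, fun h => hmf (π.injective h).symm⟩
  have hru : A.r (π u) = 0 := by
    rw [hrA, Finsupp.add_apply, Finsupp.single_eq_of_ne hπu.1, Finsupp.single_eq_of_ne hπu.2, add_zero]
  have hrf : A.r (π f) = 0 := by
    rw [hrA, Finsupp.add_apply, Finsupp.single_eq_of_ne hπf.1, Finsupp.single_eq_of_ne hπf.2, add_zero]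
  have hrB' : B.r = A.r.mapDomain π.symm := by
    rw [hrA, hrB, Finsupp.mapDomain_add, Finsupp.mapDomain_single, Finsupp.mapDomain_single, Equiv.symm_apply_apply,
      Equiv.symm_apply_apply]
  exact finrank_resVertex_eq_of_slotUnit_rel p hθi he hθ0 hdet hU hE hrel hoA hpo hoM hdivA hru hrf hrB'

end SlotUnit

end SwapNorm

end Summit.ResolutionOfSingularities.ResolutionOfSingularities.Theorems.PIDim4

end
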